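import Mathlib
import Literature.NumberTheory.Irrationality.BrownZudilin2022.TotallySymmetric
import Literature.NumberTheory.Irrationality.BrownZudilin2022.CellularZetaFive
import HarnessLib

/-!
# Brown–Zudilin 2022, Sect. 2: the recursion for the integrals `I_n` and the decomposition (5) for all `n`

Topic `Literature/NumberTheory/Irrationality/BrownZudilin2022`. Typed, cited statements (TWO named facts, statement only,
plus their PROVED consequence) read on the page from F. Brown, W. Zudilin, *On cellular rational approximations to ζ(5)*,
arXiv:2210.03391 (v3) [BrownZudilin2022], Section 2 "Totally symmetric case" (arXiv text pp. 4–5). Complements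
`TotallySymmetric.lean` (the recursion `c₃, c₂, c₁, c₀` / `SolvesRec`, its solutions `Qsol, Phat, P` with the printed initial
data, the binomial sum `Q` of (7)) and `CellularZetaFive.lean` (the integral (1), `cellularIntegral`).
HONEST FRAMING (cell `pub-zeta5`): systematic search; no irrationality claim unless certified — everything here is an identity
between real numbers (a period computation published with a computer proof); nothing is an arithmetic claim about `ζ(5)`.

## What the source says (p. 4–5, verbatim up to notation)
"The integrals `I_n` are effectively computed (up to `n = 10`) using Panzer's HyperInt [15]. We find out that we indeed have
`I_n = Q_n·(2ζ(5) + 4ζ(3)ζ(2)) − 4P̂_n·ζ(2) − 2P_n` (5) for this range; more specifically, `Q₀ = 1, Q₁ = 21, Q₂ = 2989`,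
`P̂₀ = 0, P̂₁ = 101/4, P̂₂ = 344923/96`, `P₀ = 0, P₁ = 87/4, P₂ = 1190161/384` for `n = 0, 1, 2`. Then Koutschan's
HolonomicFunctions [11] produces a third order Apéry-type recursion for the integrals `I_n`:
`c₃(n)I_{n+1} − c₂(n)I_n − c₁(n)I_{n−1} + c₀(n)I_{n−2} = 0`, where `n = 2, 3, …` [the four polynomials are those typed as
`c₃, c₂, c₁, c₀` in `TotallySymmetric.lean`], which is also satisfied by the rational coefficients `Q_n, P̂_n, P_n`. This already
proves the decomposition (5), so that `I_n = 2I′_n + 4I″_nζ(2)` with `I′_n = Q_nζ(5) − P_n` and `I″_n = Q_nζ(3) − P̂_n`."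
(Sect. 1: "details of proofs which are either obtainable by finite calculation, or have been verified by computer computation,
are omitted.")

## How it is typed
* `Isym n = cellularIntegral (n,…,n)` — the totally symmetric integral `I_n` (the parameters `(n,…,n)` converge,
  `converges_symmetric`; `cellularIntegral` is the Bochner integral of (1), whose value is the integral since it converges).
* `SolvesRecReal` — the Sect. 2 recursion for a REAL sequence (the polynomials `c₃,…,c₀` of `TotallySymmetric.lean` are
  polymorphic over commutative rings); PROVED: uniqueness from three initial values (`SolvesRecReal.ext_of_init`, as for
  `SolvesRec`, using `c₃(n) > 0` for `n ≥ 1`) and the cast of a rational solution (`SolvesRec.toReal`).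
* NAMED FACT `I_solvesRec`: the integrals satisfy the recursion for all `n ≥ 2` (the source's computer proof with [11]).
* NAMED FACT `I_init`: the three values `I₀, I₁, I₂` given by (5) with the printed table (the source's HyperInt computation,
  stated there for `n ≤ 10`; only `n = 0, 1, 2` are typed — exactly what the source's argument uses).
* THEOREM `symmetricDecomposition` — (5) for ALL `n`, with `Q_n, P̂_n, P_n` THE solutions of the recursion fixed by the printed
  initial data (`Qsol, Phat, P` of `TotallySymmetric.lean`; that `Qsol = Q` of (7) is the separate fact `Q_solvesRec`, kernel-proved by
  the cell under `Summits/…/Zeta5Search/SymmetricFamilyRecursion.lean`) — PROVED here from the two named facts (uniqueness of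
  solutions, `c₃(n) ≠ 0`), which is precisely the source's sentence "This already proves the decomposition (5)". Downstream
  statements take the two named facts `(hrec : I_solvesRec) (hinit : I_init)` as hypotheses.

NOT here: the rates (named fact `rates` in `TotallySymmetric.lean`), display (6), anything about general `a`.
-/

noncomputable section

open Filter Set MeasureTheory
open scoped Topology

namespace Literature.NumberTheory.Irrationality.BrownZudilin2022

open Literature.NumberTheory.Transcendental (zetaValue)

/-! ### The symmetric integrals and the real form of the recursion -/

/-- The totally symmetric cellular integral `I_n = I(n, …, n)` (all eight parameters equal to `n`).
[cite: BrownZudilin2022, Sect. 2] -/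
def Isym (n : ℕ) : ℝ := cellularIntegral fun _ => (n : ℤ)

/-- The number `I₀ = 2ζ(5) + 4ζ(3)ζ(2)` multiplying `Q_n` in (5). [cite: BrownZudilin2022, Sect. 2, eq. (5)] -/
def zeta5hat : ℝ := 2 * zetaValue 5 + 4 * zetaValue 3 * zetaValue 2

/-- A REAL sequence solves the recursion of Sect. 2: `c₃(n)x_{n+1} − c₂(n)x_n − c₁(n)x_{n−1} + c₀(n)x_{n−2} = 0` for all
`n ≥ 2` (same polynomials as `SolvesRec`). [cite: BrownZudilin2022, Sect. 2] -/
def SolvesRecReal (x : ℕ → ℝ) : Prop :=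
  ∀ n : ℕ, 2 ≤ n →
    c₃ (n : ℝ) * x (n + 1) - c₂ (n : ℝ) * x n - c₁ (n : ℝ) * x (n - 1) + c₀ (n : ℝ) * x (n - 2) = 0

/-- Cast of `c₃(n)` from `ℚ` to `ℝ`. [cite: BrownZudilin2022, Sect. 2] -/
theorem castReal_c₃ (n : ℕ) : ((c₃ (n : ℚ) : ℚ) : ℝ) = c₃ (n : ℝ) := by simp [c₃]
/-- Cast of `c₂(n)` from `ℚ` to `ℝ`. [cite: BrownZudilin2022, Sect. 2] -/
theorem castReal_c₂ (n : ℕ) : ((c₂ (n : ℚ) : ℚ) : ℝ) = c₂ (n : ℝ) := by simp [c₂]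
/-- Cast of `c₁(n)` from `ℚ` to `ℝ`. [cite: BrownZudilin2022, Sect. 2] -/
theorem castReal_c₁ (n : ℕ) : ((c₁ (n : ℚ) : ℚ) : ℝ) = c₁ (n : ℝ) := by simp [c₁]
/-- Cast of `c₀(n)` from `ℚ` to `ℝ`. [cite: BrownZudilin2022, Sect. 2] -/
theorem castReal_c₀ (n : ℕ) : ((c₀ (n : ℚ) : ℚ) : ℝ) = c₀ (n : ℝ) := by simp [c₀]

/-- `c₃(n) ≠ 0` in `ℝ` for `n ≥ 1`. [cite: BrownZudilin2022, Sect. 2] -/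
theorem c₃_real_ne_zero {n : ℕ} (hn : 1 ≤ n) : c₃ (n : ℝ) ≠ 0 := by
  rw [← castReal_c₃]
  exact_mod_cast c₃_ne_zero hn

/-- A rational solution of the recursion is a real solution. [cite: BrownZudilin2022, Sect. 2] -/
theorem SolvesRec.toReal {x : ℕ → ℚ} (hx : SolvesRec x) : SolvesRecReal fun n => (x n : ℝ) := by
  intro n hn
  have e := congrArg (fun q : ℚ => (q : ℝ)) (hx n hn)
  simp only [Rat.cast_add, Rat.cast_sub, Rat.cast_mul, Rat.cast_zero, castReal_c₃, castReal_c₂, castReal_c₁,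
    castReal_c₀] at e
  exact e

/-- Real solutions form a submodule: a linear combination `α x + β y + γ z` of solutions is a solution.
[cite: BrownZudilin2022, Sect. 2] -/
theorem SolvesRecReal.lincomb {x y z : ℕ → ℝ} (hx : SolvesRecReal x) (hy : SolvesRecReal y) (hz : SolvesRecReal z)
    (α β γ : ℝ) : SolvesRecReal fun n => α * x n + β * y n + γ * z n := by
  intro n hn
  have ex := hx n hn
  have ey := hy n hn
  have ez := hz n hn
  linear_combination α * ex + β * ey + γ * ez

/-- Uniqueness: two real solutions with the same three initial values coincide (`c₃(n) ≠ 0` for `n ≥ 1`).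
[cite: BrownZudilin2022, Sect. 2] -/
theorem SolvesRecReal.ext_of_init {x y : ℕ → ℝ} (hx : SolvesRecReal x) (hy : SolvesRecReal y)
    (h0 : x 0 = y 0) (h1 : x 1 = y 1) (h2 : x 2 = y 2) : x = y := by
  funext n
  induction n using Nat.strong_induction_on with
  | _ n ih =>
    rcases n with _ | _ | _ | m
    · exact h0
    · exact h1
    · exact h2
    · have ex := hx (m + 2) (by omega)
      have ey := hy (m + 2) (by omega)
      have hc : c₃ (((m + 2 : ℕ) : ℝ)) ≠ 0 := c₃_real_ne_zero (by omega)
      simp only [show m + 2 + 1 = m + 1 + 1 + 1 by omega, show m + 2 - 1 = m + 1 by omega,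
        Nat.add_sub_cancel] at ex ey
      rw [ih (m + 2) (by omega), ih (m + 1) (by omega), ih m (by omega)] at ex
      have : c₃ (((m + 2 : ℕ) : ℝ)) * (x (m + 1 + 1 + 1) - y (m + 1 + 1 + 1)) = 0 := by
        linear_combination ex - ey
      rcases mul_eq_zero.mp this with h | h
      · exact absurd h hc
      · linarith

/-! ### The two named facts of Sect. 2 about the integrals -/

/-- **The integrals `I_n` satisfy the third-order recursion** (named fact, not proved here; the source: "Koutschan's
HolonomicFunctions [11] produces a third order Apéry-type recursion for the integrals `I_n` … where `n = 2, 3, …`", a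
computer proof whose details are omitted there). [cite: BrownZudilin2022, Sect. 2 (the displayed recursion, p. 5)] -/
def I_solvesRec : Prop := SolvesRecReal Isym

/-- **The initial values `I₀, I₁, I₂`** (named fact, not proved here): (5) at `n = 0, 1, 2` with the printed table, i.e.
`I₀ = 2ζ(5) + 4ζ(3)ζ(2)`, `I₁ = 21·I₀ − 4·(101/4)ζ(2) − 2·(87/4)`, `I₂ = 2989·I₀ − 4·(344923/96)ζ(2) − 2·(1190161/384)`
(the source's HyperInt [15] computation, stated there for all `n ≤ 10`). [cite: BrownZudilin2022, Sect. 2, eq. (5) and the values after it] -/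
def I_init : Prop :=
  Isym 0 = zeta5hat ∧
    Isym 1 = 21 * zeta5hat - 4 * (101 / 4 : ℝ) * zetaValue 2 - 2 * (87 / 4 : ℝ) ∧
    Isym 2 = 2989 * zeta5hat - 4 * (344923 / 96 : ℝ) * zetaValue 2 - 2 * (1190161 / 384 : ℝ)

/-! ### The decomposition (5) for all `n` -/

/-- The right-hand side of (5) solves the recursion over `ℝ` (each of `Qsol, Phat, P` does, `recSol_solvesRec`).
[cite: BrownZudilin2022, Sect. 2] -/
theorem rhs5_solvesRecReal :
    SolvesRecReal fun n => (Qsol n : ℝ) * zeta5hat - 4 * (Phat n : ℝ) * zetaValue 2 - 2 * (P n : ℝ) := by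
  have h := SolvesRecReal.lincomb (recSol_solvesRec 1 21 2989).toReal (recSol_solvesRec 0 (101 / 4) (344923 / 96)).toReal
    (recSol_solvesRec 0 (87 / 4) (1190161 / 384)).toReal zeta5hat (-4 * zetaValue 2) (-2)
  intro n hn
  have e := h n hn
  simp only [Qsol, Phat, P]
  linear_combination e

/-- **The decomposition (5) for all `n`** ("This already proves the decomposition (5)"): the recursion for `I_n` and the three
initial values give `I_n = Q_n(2ζ(5) + 4ζ(3)ζ(2)) − 4P̂_nζ(2) − 2P_n` for every `n`, with `Q_n, P̂_n, P_n` the solutions of the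
recursion with the printed initial data (`Qsol, Phat, P`) — uniqueness of solutions, `c₃(n) ≠ 0`. PROVED from the two named facts.
[cite: BrownZudilin2022, Sect. 2, eq. (5)] -/
theorem symmetricDecomposition (hrec : I_solvesRec) (hinit : I_init) (n : ℕ) :
    Isym n = (Qsol n : ℝ) * zeta5hat - 4 * (Phat n : ℝ) * zetaValue 2 - 2 * (P n : ℝ) := by
  obtain ⟨h0, h1, h2⟩ := hinit
  have h := SolvesRecReal.ext_of_init hrec rhs5_solvesRecReal
    (by rw [h0]; simp [Qsol, Phat, P])
    (by rw [h1]; simp [Qsol, Phat, P])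
    (by rw [h2]; simp [Qsol, Phat, P])
  exact congrFun h n

/-- (5) in the `I = 2I′ + 4ζ(2)I″` form: `I_n = 2(Q_nζ(5) − P_n) + 4ζ(2)(Q_nζ(3) − P̂_n)` for all `n`.
[cite: BrownZudilin2022, Sect. 2, after eq. (5)] -/
theorem Isym_eq_two_I'_add (hrec : I_solvesRec) (hinit : I_init) (n : ℕ) :
    Isym n = 2 * ((Qsol n : ℝ) * zetaValue 5 - (P n : ℝ)) + 4 * zetaValue 2 * ((Qsol n : ℝ) * zetaValue 3 - (Phat n : ℝ)) := by
  rw [symmetricDecomposition hrec hinit n, zeta5hat]; ring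

end Literature.NumberTheory.Irrationality.BrownZudilin2022
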